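/- Width seat `ym-line-sfw-p2-w5` (prover-ym-line-sfw-p2-w5-g18-0), free hands on planner ym-idea-2 g16's LINE-19 entry kit
(crux `AllWindowsColdBox.BoxHighWindowsSU22` = stmt-QuantumFields-24004 / low item 24335, stub S4b, the v10 ONE-STEP BOOTSTRAP §10):
§Bootstrap of the planner's checked scratch `l26/S4bHelpers-scratch-v4.lean` (sha16 ee29f81e36c32e5e) — T2 and T4″ proved, T3/T4′ typed. -/
import Summits.QuantumFields.YangMills.Theorems.AllWindowsColdBoxBoxHighLineKernelHodgeForm
import Summits.QuantumFields.YangMills.Theorems.AllWindowsColdBoxBoxHighLinePlaquetteShellSum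

/-!
# LINE-19 S4b bootstrap kit: the Hodge representation (T2), the ℓ² gradient-kernel row (T4″), and the typed interfaces T3 / H4b.1′ / H4b.1

The v10 plan for the registered stub S4b `stub_landauRepresentative` (`Cruxes/BoxHighWindowsSU22/STUB-PLAN-S4b.md` §10) is a ONE-STEP
bootstrap: Stage I (✓`…BoxHighLineLandauMinimiser`: a Landau-gauge representative with crude size) + the LINEAR Hodge representation of a
divergence-free one-form through the Hodge system + quaternion BCH + kernel row sums.  This module lands the parts of the planner's kit that are
independent of the S4b statement itself:

* `hodgePlaqs H` — the plaquette index set of the Hodge system (the plaquettes of the enlarged block, as `LatticeMaxwell.Qmat` enumerates them);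
  `hodgeQ_mulVec` — `hodgeQ a = Σ_p (λ_p·a) λ_p + Σ_{x interior} (g_x·a) g_x`;
* **T2 `hodgeRepresentation`** (PROVED): a one-form `a` on the Landau free edges with `g_x·a = 0` at every interior site satisfies
  `a_e = Σ_{p ∈ hodgePlaqs H} (hodgeQ⁻¹ λ_p)_e · (λ_p·a)`; unconditional form `hodgeRepresentation'` via ✓`hodgeQ_posDef` (S2 module);
* `imVec W : Fin 3 → ℝ` — the su(2)-coordinates `(Im W₀₀, Re W₁₀, Im W₁₀)` of `W ∈ SU(2)`, the variables of T3/T5;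
* typed interfaces (Props, statements only — the provers' targets): **T3** `QuaternionBCH`, its companion `ImVecSqLeCost`, **H4b.1′**
  `LandauKernelGradDecay` (pointwise gradient decay of the Landau kernel, exponent 3, one log), **T4″** `GradKernelL2`, **H4b.1** `H4b1one`;
* **T4″ ⇐ H4b.1′ `gradKernelL2_of_gradDecay`** (PROVED; `C = 1296·C′²`) through the convergent lattice sums `sum_cube_inv_pow_six_le`
  (`Σ_{‖w‖_∞ ≤ R}(1+‖w‖₁)⁻⁶ ≤ 81 − 80/(R+1)`) and `sum_inv_pow_six_enlargedBox_le` (`≤ 16·81`); **H4b.1 ⇐ H4b.1′ `h4b1one_of_gradDecay`**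
  (PROVED) through the landed cubic shell sum ✓`plaquetteShellSum`.

Not here (blocked on a naming decision, bus 2026-08-29T12:2xZ): the assembly Prop `S4bAssembly`, whose conclusion is the v10 re-typing of
`LandauRepresentativeBound` — the tree's v9 def of that name is frozen by the append-only rule.  Lean text: planner ym-idea-2 g16 (checked scratch,
rc 0); this seat modularised it (tree lemmas `DirResponse.plaquettesIn_subset_product` / `plaquetteShellSum` instead of scratch copies, the rank-one
identity inlined) and re-checked.  HONEST LABEL: helper lemmas + typed statements toward ONE registered stub (S4b) of a critic-PASSed line on the
R2ξ″ RECORD-rung crux 24004 / 24335; the Props are OPEN targets, not results; no stub is proved by name here, no crux, rung or summit is proved; the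
Yang–Mills mass gap is NOT proved by this file.
-/

set_option autoImplicit false

noncomputable section

open Finset Matrix
open Literature.MathematicalPhysics.QuantumFieldTheory
open Literature.MathematicalPhysics.QuantumFieldTheory.LatticeMaxwell
open Literature.MathematicalPhysics.QuantumFieldTheory.AxialGauge
open Summit.QuantumFields.YangMills.Theorems.WeakCouplingRates
open Summit.QuantumFields.YangMills.Theorems.AllWindowsColdBox
open Summit.QuantumFields.YangMills.Theorems.AllWindowsColdBox.ShellSum
open Literature.Probability.LatticeModels (Site mem_halfOpenBox halfOpenBox)

namespace Summit.QuantumFields.YangMills.Theorems.AllWindowsColdBoxBoxHighLine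

/-! ## T2: the Hodge system and the linear Hodge representation -/

/-- The plaquette index set of the Hodge system of the cold box: the plaquettes of the enlarged block, exactly as `LatticeMaxwell.Qmat`
enumerates them (`plaquettesIn (halfOpenBox 4 (2H+3))` shifted to the corner `dirCorner`). -/
def hodgePlaqs (H : ℕ) : Finset (Plaq 4) := (plaquettesIn (halfOpenBox 4 (2 * H + 3))).image (Plaq.shift dirCorner)

/-- `hodgeQ a = Σ_p (λ_p·a) λ_p + Σ_{x interior} (g_x·a) g_x`. -/
theorem hodgeQ_mulVec {H : ℕ} (a : LandauFree H → ℝ) :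
    hodgeQ H *ᵥ a = (∑ p ∈ hodgePlaqs H, (landauCoeff H p ⬝ᵥ a) • landauCoeff H p) +
      ∑ x ∈ interiorSites H, (gradVec H x ⬝ᵥ a) • gradVec H x := by
  classical
  have hv : ∀ u v w : LandauFree H → ℝ, vecMulVec u v *ᵥ w = (v ⬝ᵥ w) • u := fun u v w => by
    ext i
    simp [Matrix.mulVec, dotProduct, vecMulVec_apply, Finset.mul_sum, mul_comm, mul_left_comm]
  unfold hodgeQ hodgePlaqs landauCoeff LatticeMaxwell.Qmat
  rw [Matrix.add_mulVec, Matrix.sum_mulVec, Matrix.sum_mulVec,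
    Finset.sum_image fun p _ q _ h => Plaq.shift_injective _ h]
  simp_rw [hv]

/-- **T2 (linear Hodge representation) — PROVED.**  A real one-form on the box edges which is divergence-free at the INTERIOR sites is recovered
from its plaquette circulations through the Hodge system: `a_e = Σ_p (hodgeQ⁻¹ λ_p)_e · (λ_p · a)` (only invertibility of `hodgeQ` is used; S1
`HodgePoincareColdBox` gives positive definiteness).  Applied to each su(2)-coordinate of a cold-wall configuration in lattice Landau gauge. -/
theorem hodgeRepresentation {H : ℕ} (hQ : (hodgeQ H).PosDef) (a : LandauFree H → ℝ)
    (hdiv : ∀ x ∈ interiorSites H, gradVec H x ⬝ᵥ a = 0) (e : LandauFree H) :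
    a e = ∑ p ∈ hodgePlaqs H, ((hodgeQ H)⁻¹ *ᵥ landauCoeff H p) e * (landauCoeff H p ⬝ᵥ a) := by
  classical
  have hQa : hodgeQ H *ᵥ a = ∑ p ∈ hodgePlaqs H, (landauCoeff H p ⬝ᵥ a) • landauCoeff H p := by
    rw [hodgeQ_mulVec, Finset.sum_eq_zero (s := interiorSites H) fun x hx => by rw [hdiv x hx, zero_smul], add_zero]
  have hdet : IsUnit (hodgeQ H).det := isUnit_iff_ne_zero.2 hQ.det_pos.ne'
  have ha : a = (hodgeQ H)⁻¹ *ᵥ (hodgeQ H *ᵥ a) := by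
    rw [Matrix.mulVec_mulVec, Matrix.nonsing_inv_mul _ hdet, Matrix.one_mulVec]
  conv_lhs => rw [ha, hQa]
  rw [Matrix.mulVec_sum, Finset.sum_apply]
  refine Finset.sum_congr rfl fun p _ => ?_
  rw [Matrix.mulVec_smul, Pi.smul_apply, smul_eq_mul, mul_comm]

/-- **T2, unconditional**: `hodgeQ H` IS positive definite (✓`hodgeQ_posDef`, S2 module), so the representation holds for every `H`. -/
theorem hodgeRepresentation' {H : ℕ} (a : LandauFree H → ℝ) (hdiv : ∀ x ∈ interiorSites H, gradVec H x ⬝ᵥ a = 0) (e : LandauFree H) :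
    a e = ∑ p ∈ hodgePlaqs H, ((hodgeQ H)⁻¹ *ᵥ landauCoeff H p) e * (landauCoeff H p ⬝ᵥ a) :=
  hodgeRepresentation (hodgeQ_posDef H) a hdiv e

/-! ## The su(2)-coordinates and the typed interfaces T3 / H4b.1′ / T4″ / H4b.1 (statements; OPEN targets) -/

/-- The three real su(2)-coordinates (imaginary-quaternion part) of `W ∈ SU(2)`: `(Im W₀₀, Re W₁₀, Im W₁₀)`.  For `W = [[α, −β̄],[β, ᾱ]]`:
`W − Wᴴ = [[2i·Im α, −2β̄],[2β, −2i·Im α]]`, so `InLandauGauge` (a matrix identity in `U − Uᴴ`) is the coordinatewise lattice divergence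
condition, `Σ_c (imVec W c)² = 1 − (Re α)² ∈ [½·linkDefect, linkDefect]` when `Re α ≥ 0` (`linkDefect = 2 − Re tr W = 2(1 − Re α)`). -/
def imVec (W : SU2) : Fin 3 → ℝ :=
  ![((W : Matrix (Fin 2) (Fin 2) ℂ) 0 0).im, ((W : Matrix (Fin 2) (Fin 2) ℂ) 1 0).re, ((W : Matrix (Fin 2) (Fin 2) ℂ) 1 0).im]

/-- **T3 (quaternion BCH to second order; S–M, pure `SU(2)` algebra).**  For four links with `Re W₀₀ ≥ 1/2` and all su(2)-coordinates `≤ M` in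
absolute value, the vector part of the plaquette product `W₁W₂W₃⁻¹W₄⁻¹` differs from the signed sum of the vector parts by at most
`C₁·M·Σ_k Σ_c |imVec W_k c|` (expand `(a₀+â)(b₀+b̂) = a₀b₀ − â·b̂ + a₀b̂ + b₀â + â×b̂`, `|a₀ − 1| ≤ |â|²`). -/
def QuaternionBCH : Prop :=
  ∃ C₁ : ℝ, ∀ W : Fin 4 → SU2, (∀ k, (1 : ℝ) / 2 ≤ ((W k : Matrix (Fin 2) (Fin 2) ℂ) 0 0).re) →
    ∀ M : ℝ, (∀ k c, |imVec (W k) c| ≤ M) → ∀ c : Fin 3,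
      |imVec (W 0 * W 1 * (W 2)⁻¹ * (W 3)⁻¹) c - (imVec (W 0) c + imVec (W 1) c - imVec (W 2) c - imVec (W 3) c)| ≤
        C₁ * M * ∑ k : Fin 4, ∑ c' : Fin 3, |imVec (W k) c'|

/-- The vector part of a plaquette holonomy is controlled by its cost: `Σ_c (imVec P c)² = 1 − (Re P₀₀)² ≤ 2 − Re tr P` (T3 companion; S). -/
def ImVecSqLeCost : Prop :=
  ∀ P : SU2, ∑ c : Fin 3, imVec P c ^ 2 ≤ 2 - ((P : Matrix (Fin 2) (Fin 2) ℂ).trace).re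

/-- H4b.1′ (g16 §7/§8): POINTWISE GRADIENT decay of the Landau kernel in the plaquette variable, in the tree's ℓ¹-distance convention
(LINE-18 K1 `DirResponseL1OfDipoleDecay`): `|(hodgeQ⁻¹ landauCoeff p)_e| ≤ C(1+log H)/(1+‖e−p‖₁)³` — the input H4b.1 actually needs
(S3b's kernel bound `C(1+log H)/(1+d)²` and the triangle inequality over the four edges of `p` give only `(1+d)⁻²`, i.e. row sums
`≍ H²(1+log H)`, which would only support a per-link defect `H⁴(1+log H)²s²`, NOT S4b's typed `H²(1+log H)²s²`).  Same method as S3b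
(separation of variables / reflection per component on the cube), one more difference. -/
def LandauKernelGradDecay : Prop :=
  ∃ C : ℝ, ∀ H : ℕ, 1 ≤ H → ∀ e : LandauFree H, ∀ p : Plaq 4,
    |((hodgeQ H)⁻¹ *ᵥ landauCoeff H p) e| ≤
      C * (1 + Real.log H) / (1 + (((∑ m : Fin 4, |e.1.1.1 m - p.1 m|) : ℤ) : ℝ)) ^ 3

/-- **T4″ (ℓ² row of the gradient kernel; follows from H4b.1′ by the convergent shell sum below).** -/
def GradKernelL2 : Prop :=
  ∃ C : ℝ, ∀ H : ℕ, 1 ≤ H → ∀ e : LandauFree H,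
    ∑ p ∈ hodgePlaqs H, (((hodgeQ H)⁻¹ *ᵥ landauCoeff H p) e) ^ 2 ≤ C * (1 + Real.log H) ^ 2

/-- H4b.1 with one log (the form Stage II uses; implies the `(1+log H)²` version `H4b1` for `H ≥ 1`). -/
def H4b1one : Prop :=
  ∃ C : ℝ, ∀ H : ℕ, 1 ≤ H → ∀ e : LandauFree H,
    ∑ p ∈ (plaquettesIn (Literature.Probability.LatticeModels.halfOpenBox 4 (2 * H + 3))).image (Plaq.shift dirCorner),
      |((hodgeQ H)⁻¹ *ᵥ landauCoeff H p) e| ≤ C * (H : ℝ) * (1 + Real.log H)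

/-! ## T4″ ⇐ H4b.1′ and H4b.1 ⇐ H4b.1′ (proved): the convergent `(1+d)⁻⁶` lattice sums and the landed cubic shell sum -/

/-- The convergent lattice sum `Σ_{‖w‖_∞ ≤ R} (1+‖w‖₁)⁻⁶ ≤ 81 − 80/(R+1)` (shell `r+1`: `≤ 80(r+2)³` points, each `≤ (r+2)⁻⁶`, and
`80/(r+2)³ ≤ 80/((r+1)(r+2))` telescopes). -/
theorem sum_cube_inv_pow_six_le (R : ℕ) :
    ∑ w ∈ Fintype.piFinset (fun _ : Fin 4 => Finset.Icc (-(R : ℤ)) R), 1 / (1 + ∑ m : Fin 4, (|w m| : ℝ)) ^ 6 ≤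
      81 - 80 / ((R : ℝ) + 1) := by
  induction R with
  | zero =>
    have hcube : Fintype.piFinset (fun _ : Fin 4 => Finset.Icc (-((0 : ℕ) : ℤ)) (0 : ℕ)) = {0} := by
      ext w
      rw [mem_cube, Finset.mem_singleton]
      constructor
      · intro h; funext m; have := h m; simp at this; exact this
      · rintro rfl m; simp
    rw [hcube]; norm_num
  | succ R ih =>
    have hsub := cube_subset_succ R
    rw [← Finset.sum_sdiff hsub]
    have hR : (0 : ℝ) ≤ R := Nat.cast_nonneg R
    have hshell : ∑ w ∈ Fintype.piFinset (fun _ : Fin 4 => Finset.Icc (-((R + 1 : ℕ) : ℤ)) (R + 1 : ℕ)) \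
        Fintype.piFinset (fun _ : Fin 4 => Finset.Icc (-(R : ℤ)) R), 1 / (1 + ∑ m : Fin 4, (|w m| : ℝ)) ^ 6 ≤
          80 / ((R : ℝ) + 2) ^ 3 := by
      have hterm : ∀ w ∈ Fintype.piFinset (fun _ : Fin 4 => Finset.Icc (-((R + 1 : ℕ) : ℤ)) (R + 1 : ℕ)) \
          Fintype.piFinset (fun _ : Fin 4 => Finset.Icc (-(R : ℤ)) R),
          1 / (1 + ∑ m : Fin 4, (|w m| : ℝ)) ^ 6 ≤ 1 / ((R : ℝ) + 2) ^ 6 := by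
        intro w hw
        have h1 := succ_le_l1_of_mem_sdiff hw
        have hpos : (0 : ℝ) < ((R : ℝ) + 2) ^ 6 := by positivity
        exact one_div_le_one_div_of_le hpos (pow_le_pow_left₀ (by positivity) (by linarith) 6)
      refine (Finset.sum_le_sum hterm).trans ?_
      rw [Finset.sum_const, nsmul_eq_mul, Finset.card_sdiff_of_subset hsub, card_cube, card_cube]
      have hc : (((2 * (R + 1) + 1) ^ 4 - (2 * R + 1) ^ 4 : ℕ) : ℝ) = (2 * (R : ℝ) + 3) ^ 4 - (2 * R + 1) ^ 4 := by
        have hle : (2 * R + 1) ^ 4 ≤ (2 * (R + 1) + 1) ^ 4 := Nat.pow_le_pow_left (by omega) 4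
        rw [Nat.cast_sub hle]; push_cast; ring
      rw [hc]
      have hpoly : (2 * (R : ℝ) + 3) ^ 4 - (2 * R + 1) ^ 4 ≤ 80 * ((R : ℝ) + 2) ^ 3 := by nlinarith
      have hpos : (0 : ℝ) < (R : ℝ) + 2 := by positivity
      calc ((2 * (R : ℝ) + 3) ^ 4 - (2 * R + 1) ^ 4) * (1 / ((R : ℝ) + 2) ^ 6)
          ≤ 80 * ((R : ℝ) + 2) ^ 3 * (1 / ((R : ℝ) + 2) ^ 6) :=
            mul_le_mul_of_nonneg_right hpoly (by positivity)
        _ = 80 / ((R : ℝ) + 2) ^ 3 := by field_simp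
    have htel : 80 / ((R : ℝ) + 2) ^ 3 ≤ 80 / ((R : ℝ) + 1) - 80 / ((R : ℝ) + 2) := by
      rw [div_sub_div _ _ (by positivity) (by positivity)]
      rw [div_le_div_iff₀ (by positivity) (by positivity)]
      nlinarith [hR, sq_nonneg (R : ℝ)]
    calc _ ≤ 80 / ((R : ℝ) + 2) ^ 3 + (81 - 80 / ((R : ℝ) + 1)) := add_le_add hshell ih
      _ ≤ 81 - 80 / ((R : ℝ) + 2) := by linarith [htel]
      _ = 81 - 80 / (((R + 1 : ℕ) : ℝ) + 1) := by push_cast; ring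

/-- The enlarged-box version: for `x ∈ {−1,…,2H+1}⁴`, `Σ_{q ∈ hodgePlaqs H} (1 + ‖x − q.1‖₁)⁻⁶ ≤ 16·81`. -/
theorem sum_inv_pow_six_enlargedBox_le {H : ℕ} (x : Site 4) (hx : ∀ m, -1 ≤ x m ∧ x m ≤ 2 * (H : ℤ) + 1) :
    ∑ q ∈ hodgePlaqs H, 1 / (1 + (((∑ m : Fin 4, |x m - q.1 m|) : ℤ) : ℝ)) ^ 6 ≤ 16 * 81 := by
  classical
  unfold hodgePlaqs
  set f : (Fin 4 → ℤ) → ℝ := fun w => 1 / (1 + ∑ m : Fin 4, (|w m| : ℝ)) ^ 6 with hf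
  have hf0 : ∀ w, 0 ≤ f w := fun w => by simp only [hf]; positivity
  set φ : Site 4 → (Fin 4 → ℤ) := fun y => y + dirCorner - x with hφ
  have hterm : ∀ p : Plaq 4, 1 / (1 + (((∑ m : Fin 4, |x m - (Plaq.shift dirCorner p).1 m|) : ℤ) : ℝ)) ^ 6 = f (φ p.1) := by
    intro p
    simp only [hf, hφ, Plaq.shift_fst, Int.cast_sum, Int.cast_abs, Int.cast_sub, Pi.add_apply, Pi.sub_apply]
    congr 2; congr 1
    refine Finset.sum_congr rfl fun m _ => ?_
    rw [← abs_neg]; congr 1; push_cast; ring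
  rw [Finset.sum_image fun p _ q _ h => Plaq.shift_injective _ h]
  simp_rw [hterm]
  have h1 : ∑ p ∈ plaquettesIn (halfOpenBox 4 (2 * H + 3)), f (φ p.1) ≤
      ∑ p ∈ halfOpenBox 4 (2 * H + 3) ×ˢ ((Finset.univ : Finset (Fin 4)) ×ˢ (Finset.univ : Finset (Fin 4))), f (φ p.1) :=
    Finset.sum_le_sum_of_subset_of_nonneg (DirResponse.plaquettesIn_subset_product _) fun _ _ _ => hf0 _
  refine h1.trans ?_
  rw [Finset.sum_product]
  have hconst : ∀ y : Site 4,
      ∑ _z ∈ (Finset.univ : Finset (Fin 4)) ×ˢ (Finset.univ : Finset (Fin 4)), f (φ y) = 16 * f (φ y) := fun y => by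
    rw [Finset.sum_const, Finset.card_product, Finset.card_univ, Fintype.card_fin, nsmul_eq_mul]; norm_num
  simp_rw [hconst]
  rw [← Finset.mul_sum]
  refine mul_le_mul_of_nonneg_left ?_ (by norm_num)
  have hφinj : Set.InjOn φ (halfOpenBox 4 (2 * H + 3) : Set (Site 4)) := by
    intro a _ b _ hab
    simp only [hφ] at hab
    have := congr_arg (fun w => w - dirCorner + x) hab
    simpa using this
  rw [← Finset.sum_image hφinj]
  have hR : ∑ w ∈ Fintype.piFinset (fun _ : Fin 4 => Finset.Icc (-((2 * H + 2 : ℕ) : ℤ)) (2 * H + 2 : ℕ)), f w ≤ 81 :=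
    (sum_cube_inv_pow_six_le (2 * H + 2)).trans (by
      have : (0 : ℝ) ≤ 80 / (((2 * H + 2 : ℕ) : ℝ) + 1) := by positivity
      linarith)
  refine (Finset.sum_le_sum_of_subset_of_nonneg ?_ fun _ _ _ => hf0 _).trans hR
  intro w hw
  obtain ⟨y, hy, rfl⟩ := Finset.mem_image.1 hw
  rw [mem_cube]
  intro m
  have hym := (mem_halfOpenBox.1 (Finset.mem_coe.1 hy)) m
  have hxm := hx m
  simp only [hφ, Pi.add_apply, Pi.sub_apply, dirCorner]
  rw [abs_le]; push_cast; constructor <;> omega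

/-- **T4″ from H4b.1′ — PROVED** (`C = 1296·C′²`): square the pointwise gradient decay and sum the convergent series. -/
theorem gradKernelL2_of_gradDecay (h1 : LandauKernelGradDecay) : GradKernelL2 := by
  obtain ⟨C, hC⟩ := h1
  refine ⟨16 * 81 * C ^ 2, fun H hH e => ?_⟩
  have hx : ∀ m, -1 ≤ e.1.1.1 m ∧ e.1.1.1 m ≤ 2 * (H : ℤ) + 1 := fun m => by
    have hmem := LatticeMaxwell.mem_boxEdgesAt.1 e.1.2
    rcases e' : e.1.1 with ⟨y, i⟩
    rw [e'] at hmem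
    have hk := ((mem_boxEdges_iff.1 hmem).1) m
    simp only [Pi.sub_apply, dirCorner] at hk
    show -1 ≤ y m ∧ y m ≤ 2 * (H : ℤ) + 1
    push_cast at hk
    constructor <;> omega
  have hlog : 0 ≤ 1 + Real.log (H : ℝ) := by
    have : (1 : ℝ) ≤ H := by exact_mod_cast hH
    linarith [Real.log_nonneg this]
  have hterm : ∀ p ∈ hodgePlaqs H, (((hodgeQ H)⁻¹ *ᵥ landauCoeff H p) e) ^ 2 ≤
      (C * (1 + Real.log H)) ^ 2 * (1 / (1 + (((∑ m : Fin 4, |e.1.1.1 m - p.1 m|) : ℤ) : ℝ)) ^ 6) := by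
    intro p _
    have hb := hC H hH e p
    have hd : (0 : ℝ) < 1 + (((∑ m : Fin 4, |e.1.1.1 m - p.1 m|) : ℤ) : ℝ) := by positivity
    have habs : |((hodgeQ H)⁻¹ *ᵥ landauCoeff H p) e| ≤ C * (1 + Real.log H) / (1 + (((∑ m : Fin 4, |e.1.1.1 m - p.1 m|) : ℤ) : ℝ)) ^ 3 := hb
    have h0 : 0 ≤ C * (1 + Real.log H) / (1 + (((∑ m : Fin 4, |e.1.1.1 m - p.1 m|) : ℤ) : ℝ)) ^ 3 := (abs_nonneg _).trans habs
    calc (((hodgeQ H)⁻¹ *ᵥ landauCoeff H p) e) ^ 2 = |((hodgeQ H)⁻¹ *ᵥ landauCoeff H p) e| ^ 2 := (sq_abs _).symm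
      _ ≤ (C * (1 + Real.log H) / (1 + (((∑ m : Fin 4, |e.1.1.1 m - p.1 m|) : ℤ) : ℝ)) ^ 3) ^ 2 :=
          pow_le_pow_left₀ (abs_nonneg _) habs 2
      _ = (C * (1 + Real.log H)) ^ 2 * (1 / (1 + (((∑ m : Fin 4, |e.1.1.1 m - p.1 m|) : ℤ) : ℝ)) ^ 6) := by
          field_simp
  calc ∑ p ∈ hodgePlaqs H, (((hodgeQ H)⁻¹ *ᵥ landauCoeff H p) e) ^ 2
      ≤ ∑ p ∈ hodgePlaqs H, (C * (1 + Real.log H)) ^ 2 * (1 / (1 + (((∑ m : Fin 4, |e.1.1.1 m - p.1 m|) : ℤ) : ℝ)) ^ 6) :=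
        Finset.sum_le_sum hterm
    _ = (C * (1 + Real.log H)) ^ 2 * ∑ p ∈ hodgePlaqs H, 1 / (1 + (((∑ m : Fin 4, |e.1.1.1 m - p.1 m|) : ℤ) : ℝ)) ^ 6 := by
        rw [Finset.mul_sum]
    _ ≤ (C * (1 + Real.log H)) ^ 2 * (16 * 81) :=
        mul_le_mul_of_nonneg_left (sum_inv_pow_six_enlargedBox_le (H := H) e.1.1.1 hx) (by positivity)
    _ = 16 * 81 * C ^ 2 * (1 + Real.log H) ^ 2 := by ring

/-- **H4b.1′ ⇒ H4b.1 (one log)**: termwise gradient decay, then the landed shell sum `plaquetteShellSum` (H4b.1″, `C = 5136`). -/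
theorem h4b1one_of_gradDecay (h1 : LandauKernelGradDecay) : H4b1one := by
  obtain ⟨C, hC⟩ := h1
  obtain ⟨C', hC'⟩ : ∃ C' : ℝ, ∀ H : ℕ, 1 ≤ H → ∀ e : LandauFree H,
      ∑ p ∈ (plaquettesIn (Literature.Probability.LatticeModels.halfOpenBox 4 (2 * H + 3))).image (Plaq.shift dirCorner),
        1 / (1 + (((∑ m : Fin 4, |e.1.1.1 m - p.1 m|) : ℤ) : ℝ)) ^ 3 ≤ C' * (H : ℝ) :=
    ⟨5136, fun H hH e => plaquetteShellSum hH e⟩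
  refine ⟨max C 0 * C', fun H hH e => ?_⟩
  have hlog : 0 ≤ 1 + Real.log H := by
    have : (1 : ℝ) ≤ H := by exact_mod_cast hH
    linarith [Real.log_nonneg this]
  have hden : ∀ p : Plaq 4, (0 : ℝ) < (1 + (((∑ m : Fin 4, |e.1.1.1 m - p.1 m|) : ℤ) : ℝ)) ^ 3 := fun p => by positivity
  calc ∑ p ∈ (plaquettesIn (Literature.Probability.LatticeModels.halfOpenBox 4 (2 * H + 3))).image (Plaq.shift dirCorner),
        |((hodgeQ H)⁻¹ *ᵥ landauCoeff H p) e|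
      ≤ ∑ p ∈ (plaquettesIn (Literature.Probability.LatticeModels.halfOpenBox 4 (2 * H + 3))).image (Plaq.shift dirCorner),
        max C 0 * (1 + Real.log H) * (1 / (1 + (((∑ m : Fin 4, |e.1.1.1 m - p.1 m|) : ℤ) : ℝ)) ^ 3) := by
        refine Finset.sum_le_sum fun p _ => (hC H hH e p).trans ?_
        rw [mul_one_div, div_le_div_iff_of_pos_right (hden p)]
        exact mul_le_mul_of_nonneg_right (le_max_left _ _) hlog
    _ = max C 0 * (1 + Real.log H) *
        ∑ p ∈ (plaquettesIn (Literature.Probability.LatticeModels.halfOpenBox 4 (2 * H + 3))).image (Plaq.shift dirCorner),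
          1 / (1 + (((∑ m : Fin 4, |e.1.1.1 m - p.1 m|) : ℤ) : ℝ)) ^ 3 := by rw [Finset.mul_sum]
    _ ≤ max C 0 * (1 + Real.log H) * (C' * H) :=
        mul_le_mul_of_nonneg_left (hC' H hH e) (mul_nonneg (le_max_right _ _) hlog)
    _ = max C 0 * C' * (H : ℝ) * (1 + Real.log H) := by ring

end Summit.QuantumFields.YangMills.Theorems.AllWindowsColdBoxBoxHighLine

end
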